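import Summits.Ventures.GridStability.Models.InverterInstances

/-!
# GridStability/Models/InverterInstancesTwinV5s — the §V-consistent TWIN «GFM-SMIB-QoriaV5s» of the G3.a instance of record (droop gain `m_p = 0.04`, `H_VSC = 5 s` ⇒ `ω_c = 5/2`)

Cell `gridfusion` (LADDER-GRIDFUSION rung G3.a; seat gridfusion-model-3 (g9); lead g8 RULING 9j (3)
«G3.a-TWIN-QORIAV5S = YES, LOW, a record only — it makes a like-for-like comparator possible next wave»).
PROVENANCE P-INV-7 (model-3 g9, adopted as the cell's reading by RULING 9j (3); page read lit-2
16:18:41Z): Chapter V of [cite: Qoria2020] prints NO droop gain (Table V-1 [corpus:paper:galaxy-pdf-947812980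
p0102 L60–p0103 L6] has six entries, none of them `m_p`) and runs the thesis's standing 4 % droop
`m_p = k_i/ω_b = 0.04` [Table III-1 p0058 L3–L6; mock-up Table VI-3 p0120 L34–L38] — (V-28) reproduces the
printed `t_cSAT = 63.7` ms only for `m_p ≈ 0.040`, and the §V.3.6 pair «`t_c = 350` ms (`H_VSC ∼ 0`) /
`498` ms (`H_VSC = 5` s)» at `p* = 0.5` [p0108 L19] is incompatible with `m_p = 0.003` under (V-26)–(V-27)
— whereas the instance of record `gfmSmibQoriaV4` (p469363) carries the §III.4.2.2 damping-design couple
`(k_i/ω_b, ω_c) = (0.003, 33)` [p0067 L24] (its own PROVENANCE clause). With `m_p = 0.04` the printed `H_VSC = 5 s`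
forces `ω_c = ω_b/(2 H k_i) = 5/2` rad/s ((III-22)). THIS FILE types that twin: SAME `ω_b′`, `P_max`,
`p*′`, equilibrium circle point `δˢ = arcsin(2072640/16581121)` and SAME virtual inertia
`M = 1/(k_i ω_c) = 113/3550` as the record of record; ONLY the damping changes: `D = 1/k_i = 113/1420`
(`D/M = ω_c = 5/2 s⁻¹` instead of `33`). Recast data (interface I2) for a future certificate:
`a = k_i ω_c P_max c* = 233605208200/1873666673`, `b = 29431488000/1873666673` (both UNCHANGED — they
depend on `k_i ω_c` only), `d = ω_c = 5/2`. No certificate, no clearing-time statement is made here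
(the print's 498 ms case also has the VI active after clearing, Fig. V-19/V-20 — still not like-for-like
for an unlimited model). MODELLED: MV-6D + MV-P + MV-Ω + P-INV-7; nothing about any converter.
-/

noncomputable section

open Real

namespace Summit.Ventures.GridStability.Models.InverterDroop

/-- «GFM-SMIB-QoriaV5s»: `ω_b′ = 35500/113`, `ω_c = 5/2` rad/s, `k_i = ω_b′/25 = 1420/113` (`m_p = 0.04`,
P-INV-7), `p*′ = 8290560/16581121` (eq=b of record), `P_max = 4`, `ω_set = ω_e = 1`
[cite: Qoria2020, §V.3.6/§V.4 with (III-22), (V-13)–(V-14)]. MODELLED: MV-6D + MV-P + MV-Ω + P-INV-7. -/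
def gfmSmibQoriaV5s : ReducedParams where
  ωb := 35500 / 113
  ωc := 5 / 2
  ki := 1420 / 113
  pref := 8290560 / 16581121
  Pmax := 4
  ωset := 1
  ωe := 1

namespace gfmSmibQoriaV5s

/-- Nonzero base frequency. -/
theorem ωb_ne_zero : gfmSmibQoriaV5s.ωb ≠ 0 := by norm_num [gfmSmibQoriaV5s]

/-- Nonzero droop gain. -/
theorem ki_ne_zero : gfmSmibQoriaV5s.ki ≠ 0 := by norm_num [gfmSmibQoriaV5s]

/-- Nonzero filter cut-off. -/
theorem ωc_ne_zero : gfmSmibQoriaV5s.ωc ≠ 0 := by norm_num [gfmSmibQoriaV5s]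

/-- `ω_set = ω_e`. -/
theorem ωset_eq : gfmSmibQoriaV5s.ωset = gfmSmibQoriaV5s.ωe := rfl

/-- The droop gain is `m_p ω_b′` with `m_p = 1/25` (P-INV-7). -/
theorem ki_eq : gfmSmibQoriaV5s.ki = gfmSmibQoriaV5s.ωb / 25 := by norm_num [gfmSmibQoriaV5s]

/-- `k_i ω_c = ω_b′/10`, i.e. `H_VSC = ω_b/(2 ω_c k_i) = 5 s` exactly [cite: Qoria2020, (III-22)] — the SAME
virtual inertia as `gfmSmibQoriaV4`. -/
theorem ki_mul_ωc : gfmSmibQoriaV5s.ki * gfmSmibQoriaV5s.ωc = gfmSmibQoriaV5s.ωb / 10 := by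
  norm_num [gfmSmibQoriaV5s]

/-- `H_VSC = 5` [s]. -/
theorem inertia_constant :
    gfmSmibQoriaV5s.ωb / (2 * gfmSmibQoriaV5s.ωc * gfmSmibQoriaV5s.ki) = 5 := by
  norm_num [gfmSmibQoriaV5s]

/-- Power balance at the equilibrium angle of record `δˢ` (eq=b, EXACT): `P_max sin δˢ = p*′`. -/
theorem power_balance : gfmSmibQoriaV5s.Pmax * sin gfmSmibQoriaV4_δs = gfmSmibQoriaV5s.pref := by
  rw [sin_gfmSmibQoriaV4_δs]; norm_num [gfmSmibQoriaV5s]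

/-- `(δˢ, ω_e)` is an equilibrium of the twin. -/
theorem isEquilibrium : gfmSmibQoriaV5s.IsEquilibrium gfmSmibQoriaV4_δs gfmSmibQoriaV5s.ωe :=
  gfmSmibQoriaV5s.isEquilibrium_of_sin_eq _ ωset_eq power_balance

/-- SMIB reading: `M = 1/(k_i ω_c) = 113/3550` — unchanged w.r.t. `gfmSmibQoriaV4`. -/
theorem toGridSMIB_M : gfmSmibQoriaV5s.toGridSMIB.M = 113 / 3550 := by
  norm_num [ReducedParams.toGridSMIB, gfmSmibQoriaV5s]

/-- SMIB reading: `D = 1/k_i = 113/1420 = 25/ω_b′` — `330/25 = 13.2` times SMALLER than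
`gfmSmibQoriaV4`'s `3729/3550`; `D/M = ω_c = 5/2 s⁻¹`. -/
theorem toGridSMIB_D : gfmSmibQoriaV5s.toGridSMIB.D = 113 / 1420 := by
  norm_num [ReducedParams.toGridSMIB, gfmSmibQoriaV5s]

/-- `D/M = ω_c = 5/2`. -/
theorem toGridSMIB_D_div_M : gfmSmibQoriaV5s.toGridSMIB.D / gfmSmibQoriaV5s.toGridSMIB.M = 5 / 2 := by
  norm_num [ReducedParams.toGridSMIB, gfmSmibQoriaV5s]

/-- A1 relation `a = k_i ω_c P_max cos δˢ = 233605208200/1873666673` (same as the record of record). -/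
theorem rel_a : ((233605208200 / 1873666673 : ℚ) : ℝ)
    = gfmSmibQoriaV5s.ki * gfmSmibQoriaV5s.ωc * gfmSmibQoriaV5s.Pmax * cos gfmSmibQoriaV4_δs := by
  rw [cos_gfmSmibQoriaV4_δs]; norm_num [gfmSmibQoriaV5s]

/-- A1 relation `b = k_i ω_c P_max sin δˢ = 29431488000/1873666673` (same as the record of record). -/
theorem rel_b : ((29431488000 / 1873666673 : ℚ) : ℝ)
    = gfmSmibQoriaV5s.ki * gfmSmibQoriaV5s.ωc * gfmSmibQoriaV5s.Pmax * sin gfmSmibQoriaV4_δs := by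
  rw [sin_gfmSmibQoriaV4_δs]; norm_num [gfmSmibQoriaV5s]

/-- A1 relation `d = ω_c = 5/2` (the recast damping rate is the power-filter cut-off). -/
theorem rel_d : ((5 / 2 : ℚ) : ℝ) = gfmSmibQoriaV5s.ωc := by norm_num [gfmSmibQoriaV5s]

/-- **Interface I2 for the twin.** Along every solution of «GFM-SMIB-QoriaV5s» the recast curve
`z(t) = SMIB.embed δˢ (δ t, ω_b′(ω t − ω_e))` satisfies `dz_k/dt = f_k(z)` with
`f = SMIB.polyField (233605208200/1873666673) (29431488000/1873666673) (5/2)` on `{SMIB.hcon = 0}`: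
a future Bench certificate for THIS `polyField` is a certificate about the §V-consistent converter model. -/
theorem embed_hasDerivWithinAt {δ ω : ℝ → ℝ} (h : gfmSmibQoriaV5s.IsSolution δ ω) {s : Set ℝ}
    {t : ℝ} (ht : t ∈ s) (k : Fin 3) :
    HasDerivWithinAt
      (fun τ => Models.SMIB.embed gfmSmibQoriaV4_δs (gfmSmibQoriaV5s.toGridState (δ τ, ω τ)) k)
      (((Models.SMIB.polyField (233605208200 / 1873666673) (29431488000 / 1873666673) (5 / 2)).getD k
          []).eval
        (Models.SMIB.embed gfmSmibQoriaV4_δs (gfmSmibQoriaV5s.toGridState (δ t, ω t)))) s t :=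
  ReducedParams.hasDerivWithinAt_embed gfmSmibQoriaV5s ωb_ne_zero ki_ne_zero ωc_ne_zero ωset_eq
    rel_a rel_b rel_d power_balance h ht k

end gfmSmibQoriaV5s

end Summit.Ventures.GridStability.Models.InverterDroop

end
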